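import Mathlib
import Summits.CriticalPhenomena.CardyFormulaZ2.Theorems.CardySelfRefinementDefs
import Summits.CriticalPhenomena.CardyFormulaZ2.Theorems.CardySelfRefinementTrivialSectorRateStubLocalEngineRotation
import Summits.CriticalPhenomena.CardyFormulaZ2.Theorems.CardySelfRefinementTrivialSectorRateStubLocalEngineRotationCoins
import Summits.CriticalPhenomena.CardyFormulaZ2.Theorems.CardySelfRefinementTrivialSectorRateStubLocalEngineRotationCond
import Literature.Probability.Percolation.SelfRefinementMeasure
import HarnessLib

/-!
# Stub `stub_localEngine` of line `far-field-is-a-quarter-turn` (crux `TrivialSectorRate`,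
stmt-CriticalPhenomena-10266): the coin window of the `R`-box about `k•u` is invariant under the
quarter turn when `k ∣ R`

Companion of `…StubLocalEngineRotation[Coins|Cond].lean`.  The engine `stub_localEngine`
conditions on the coins off the window `K_R = coinWindow k (boxEdgesAt (ctr k u) R)` (the coins
read by the edges of the lattice box of radius `R` about the block centre `k•u`; each edge reads
its own coin and, over-approximating, the shared coin and the selector of the bundle labelled by
its coarse base `tb`).  The conditional transport `cond_infl_quarterTurn` replaces the window `K` by
`σ ⁻¹' K`; here we show `σ ⁻¹' K_R = K_R` for the coin permutation `σ` of the quarter turn about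
`k•u` PROVIDED `k ∣ R` (`preimage_coinWindow_quarterTurn`; for `k ∤ R` this fails: the bundle
label attached to a non-axial vertical edge in the outermost coarse column rotates to a label read
by no edge of the box), and restate the conditional equivariance of influences with the SAME window
on both sides (`cond_infl_quarterTurn_window`, registered).

Ingredients: `mem_coinWindow_iff`, `edgeOf_mem_boxEdgesAt_iff` (coordinates), the own coin of an
edge of the box goes to the own coin of an edge of the box (`quarterTurn_edge_mem_boxEdgesAt`, the
box is a `C₄(k•u)`-invariant set of sites), the bundle coins `(tb k (v,d), d, j)` go to the bundle
coins of an explicit edge of the box (`quarterTurn_tuple_witness`: for `d = 0` the rotated edge,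
for `d = 1` the horizontal edge based at `(v₁ − c₁ + c₀, c₀ + c₁ − k⌊v₀/k⌋)`, inside the box because
`c₀ − R` is a multiple of `k` below `v₀`), so `σ` maps the finite set `K_R` into itself
(`quarterTurn_mapsTo_coinWindow`, `boxEdgesAt_finite`), hence onto itself.
-/

noncomputable section

namespace Summit.CriticalPhenomena.CardyFormulaZ2.Theorems.CardySelfRefinement.FarField

open Set MeasureTheory
open Literature.Probability.LatticeModels Literature.Probability.Percolation
open Literature.Probability.Percolation.QuadCrossing
open Summit.CriticalPhenomena.CardyFormulaZ2.Theses.CardySelfRefinement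

/-! ### Membership in the coin window of a box -/

/-- Membership in the coin window of an edge set: some edge of the set reads the coin. -/
theorem mem_coinWindow_iff (k : ℕ) (W : Set (Sym2 (Site 2))) (x : Coin) :
    x ∈ coinWindow k W ↔ ∃ vd : Site 2 × Fin 2, edgeOf vd ∈ W ∧ x ∈ coinsOf k vd := by
  simp only [coinWindow, Set.mem_iUnion, Set.mem_preimage, exists_prop]

/-- The fine edge `(v,d)` lies in the `R`-box about `c` iff both endpoints do (coordinatewise). -/
theorem edgeOf_mem_boxEdgesAt_iff (c : Site 2) (R : ℕ) (v : Site 2) (d : Fin 2) :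
    edgeOf (v, d) ∈ boxEdgesAt c R ↔
      ∀ i, (-(R : ℤ) ≤ v i - c i ∧ v i - c i ≤ R) ∧
        (-(R : ℤ) ≤ v i + dirVec d i - c i ∧ v i + dirVec d i - c i ≤ R) := by
  constructor
  · rintro ⟨-, h⟩ i
    have h1 := h v (Sym2.mem_mk_left _ _)
    have h2 := h (v + dirVec d) (Sym2.mem_mk_right _ _)
    rw [mem_box] at h1 h2
    exact ⟨h1 i, h2 i⟩
  · intro h
    refine ⟨?_, fun w hw => ?_⟩
    · rw [SimpleGraph.mem_edgeSet]
      exact (zdGraph_adj_iff _ _).2 ⟨d, Or.inl (by simp only [dirVec]; rw [dirVec_eq_single])⟩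
    · rw [mem_box]
      intro i
      rcases Sym2.mem_iff.1 hw with rfl | rfl
      · exact (h i).1
      · exact (h i).2

/-- The lattice box of edges is finite. -/
theorem boxEdgesAt_finite (c : Site 2) (R : ℕ) : (boxEdgesAt c R).Finite := by
  have hS : {v : Site 2 | v - c ∈ box 2 R}.Finite := by
    refine ((box 2 R).image (· + c)).finite_toSet.subset fun v hv => ?_
    simp only [Finset.coe_image, Set.mem_image, Finset.mem_coe]
    exact ⟨v - c, hv, sub_add_cancel v c⟩
  refine hS.toFinset.sym2.finite_toSet.subset fun e he => ?_
  rw [Finset.mem_coe, Finset.mem_sym2_iff]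
  intro a ha
  rw [Set.Finite.mem_toFinset]
  exact he.2 a ha

/-! ### The quarter turn maps the coin window of the `R`-box into itself (`k ∣ R`) -/

/-- **The box of edges is `C₄(k•u)`-invariant**: the own coin of an edge of the `R`-box about `k•u`
goes, under the coin permutation of the quarter turn, to the own coin of an edge of the box. -/
theorem quarterTurn_edge_mem_boxEdgesAt {k : ℕ} {u : Site 2} (σ : Coin ≃ Coin)
    (h0 : ∀ (v : Site 2) (d : Fin 2), σ (v, d, 0) =
      (![v 1 - ctr k u 1 + ctr k u 0, ctr k u 0 + ctr k u 1 - v 0 - (if d = 0 then 1 else 0)],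
        Equiv.swap 0 1 d, 0)) {R : ℕ} {v : Site 2} {d : Fin 2}
    (hvd : edgeOf (v, d) ∈ boxEdgesAt (ctr k u) R) :
    edgeOf ((σ (v, d, 0)).1, (σ (v, d, 0)).2.1) ∈ boxEdgesAt (ctr k u) R := by
  rw [edgeOf_mem_boxEdgesAt_iff] at hvd ⊢
  have h₀ := hvd 0
  have h₁ := hvd 1
  rw [h0]
  fin_cases d
  · simp only [dirVec, Fin.zero_eta, Fin.isValue, ↓reduceIte, Matrix.cons_val_zero, Matrix.cons_val_one,
      Matrix.cons_val_fin_one] at h₀ h₁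
    intro i
    fin_cases i <;>
      simp only [dirVec, Fin.zero_eta, Fin.isValue, Fin.mk_one, ↓reduceIte, one_ne_zero,
        Equiv.swap_apply_left, Matrix.cons_val_zero, Matrix.cons_val_one, Matrix.cons_val_fin_one] <;>
      omega
  · simp only [dirVec, Fin.mk_one, Fin.isValue, one_ne_zero, ↓reduceIte, Matrix.cons_val_zero,
      Matrix.cons_val_one, Matrix.cons_val_fin_one] at h₀ h₁
    intro i
    fin_cases i <;>
      simp only [dirVec, Fin.zero_eta, Fin.isValue, Fin.mk_one, ↓reduceIte, one_ne_zero, sub_zero,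
        Equiv.swap_apply_right, Matrix.cons_val_zero, Matrix.cons_val_one, Matrix.cons_val_fin_one] <;>
      omega

/-- The coarse base of the rotated edge of a HORIZONTAL edge `(v,0)` (axial or not):
`(⌊v₁/k⌋ − u₁ + u₀, u₀ + u₁ − ⌊v₀/k⌋ − 1)` (`k > 0`). -/
theorem tb_quarterTurn_edge_zero {k : ℕ} (hk : 0 < k) {u : Site 2} (σ : Coin ≃ Coin)
    (h0 : ∀ (v : Site 2) (d : Fin 2), σ (v, d, 0) =
      (![v 1 - ctr k u 1 + ctr k u 0, ctr k u 0 + ctr k u 1 - v 0 - (if d = 0 then 1 else 0)],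
        Equiv.swap 0 1 d, 0)) (v : Site 2) :
    tb k ((σ (v, 0, 0)).1, (σ (v, 0, 0)).2.1) = ![v 1 / k - u 1 + u 0, u 0 + u 1 - v 0 / k - 1] := by
  have hk' : (0 : ℤ) < k := by exact_mod_cast hk
  have hA : (v 1 - ctr k u 1 + ctr k u 0) / (k : ℤ) = v 1 / k - u 1 + u 0 := by
    rw [ctr_apply, ctr_apply, show v 1 - (k : ℤ) * u 1 + k * u 0 = v 1 + k * (u 0 - u 1) by ring,
      Int.add_mul_ediv_left _ _ hk'.ne']
    ring
  have hB : (ctr k u 0 + ctr k u 1 - v 0 - 1) / (k : ℤ) = u 0 + u 1 - v 0 / k - 1 := by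
    rw [ctr_apply, ctr_apply,
      show (k : ℤ) * u 0 + k * u 1 - v 0 - 1 = (-v 0 - 1) + k * (u 0 + u 1) by ring,
      Int.add_mul_ediv_left _ _ hk'.ne',
      Literature.NumberTheory.Transcendental.Int.neg_sub_one_ediv_eq _ hk']
    ring
  rw [h0]
  funext i
  fin_cases i
  · simpa [tb] using hA
  · simpa [tb] using hB

/-- **The bundle coins of the window go to bundle coins of the window** (`k ∣ R`, `k > 0`): for an
edge `(v,d)` of the `R`-box about `k•u` there is an edge `vd'` of the box such that the coin
permutation of the quarter turn carries the shared coin and the selector attached to `(v,d)`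
(label `(tb k (v,d), d)`) to those attached to `vd'` — for `d = 0` the rotated edge, for `d = 1`
the horizontal edge based at `(v₁ − c₁ + c₀, c₀ + c₁ − k⌊v₀/k⌋)`. -/
theorem quarterTurn_tuple_witness {k : ℕ} (hk : 0 < k) (u : Site 2) (σ : Coin ≃ Coin)
    (h0 : ∀ (v : Site 2) (d : Fin 2), σ (v, d, 0) =
      (![v 1 - ctr k u 1 + ctr k u 0, ctr k u 0 + ctr k u 1 - v 0 - (if d = 0 then 1 else 0)],
        Equiv.swap 0 1 d, 0))
    (h : ∀ (t : Site 2) (d : Fin 2) (j : Fin 3), j ≠ 0 → σ (t, d, j) =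
      (![t 1 - u 1 + u 0, u 0 + u 1 - t 0 - (if d = 0 then 1 else 0)], Equiv.swap 0 1 d, j))
    {R : ℕ} (hR : k ∣ R) {v : Site 2} {d : Fin 2} (hvd : edgeOf (v, d) ∈ boxEdgesAt (ctr k u) R) :
    ∃ vd' : Site 2 × Fin 2, edgeOf vd' ∈ boxEdgesAt (ctr k u) R ∧
      ∀ j : Fin 3, j ≠ 0 → σ (tb k (v, d), d, j) = (tb k vd', vd'.2, j) := by
  have hk' : (0 : ℤ) < k := by exact_mod_cast hk
  fin_cases d
  · -- horizontal edge: the rotated edge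
    refine ⟨((σ (v, 0, 0)).1, (σ (v, 0, 0)).2.1), quarterTurn_edge_mem_boxEdgesAt σ h0 hvd,
      fun j hj => ?_⟩
    rw [h _ _ _ hj, tb_quarterTurn_edge_zero hk σ h0 v, h0]
    simp [tb]
  · -- vertical edge: the horizontal edge based at `(v₁ − c₁ + c₀, c₀ + c₁ − k⌊v₀/k⌋)`
    obtain ⟨n, rfl⟩ := hR
    have hF1 : (k : ℤ) * (v 0 / k) ≤ v 0 := Int.mul_ediv_self_le hk'.ne'
    rw [edgeOf_mem_boxEdgesAt_iff] at hvd
    have h₀ := hvd 0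
    have h₁ := hvd 1
    simp only [dirVec, Fin.mk_one, Fin.isValue, one_ne_zero, ↓reduceIte, Matrix.cons_val_zero,
      Matrix.cons_val_one, Matrix.cons_val_fin_one, Nat.cast_mul] at h₀ h₁
    have hF3 : ctr k u 0 - (k : ℤ) * n ≤ k * (v 0 / k) := by
      have h1 : (u 0 - n) * (k : ℤ) ≤ v 0 := by rw [ctr_apply] at h₀; linarith [h₀.1.1]
      have h2 : u 0 - n ≤ v 0 / k := Int.le_ediv_of_mul_le hk' h1
      rw [ctr_apply]
      nlinarith
    refine ⟨(![v 1 - ctr k u 1 + ctr k u 0, ctr k u 0 + ctr k u 1 - k * (v 0 / k)], 0), ?_,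
      fun j hj => ?_⟩
    · rw [edgeOf_mem_boxEdgesAt_iff]
      intro i
      fin_cases i <;>
        simp only [dirVec, Fin.zero_eta, Fin.isValue, Fin.mk_one, ↓reduceIte, Matrix.cons_val_zero,
          Matrix.cons_val_one, Matrix.cons_val_fin_one, Nat.cast_mul] <;>
        omega
    · have hA : (v 1 - ctr k u 1 + ctr k u 0) / (k : ℤ) = v 1 / k - u 1 + u 0 := by
        rw [ctr_apply, ctr_apply,
          show v 1 - (k : ℤ) * u 1 + k * u 0 = v 1 + k * (u 0 - u 1) by ring,
          Int.add_mul_ediv_left _ _ hk'.ne']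
        ring
      have hB : (ctr k u 0 + ctr k u 1 - (k : ℤ) * (v 0 / k)) / (k : ℤ) = u 0 + u 1 - v 0 / k := by
        rw [ctr_apply, ctr_apply,
          show (k : ℤ) * u 0 + k * u 1 - k * (v 0 / k) = k * (u 0 + u 1 - v 0 / k) by ring,
          Int.mul_ediv_cancel_left _ hk'.ne']
      rw [h _ _ _ hj]
      simp only [Fin.mk_one, Fin.isValue, one_ne_zero, ↓reduceIte, sub_zero, Equiv.swap_apply_right,
        Prod.mk.injEq, and_true]
      funext i
      fin_cases i
      · simpa [tb] using hA.symm
      · simpa [tb] using hB.symm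

/-- **The coin permutation of the quarter turn maps the coin window of the `R`-box about `k•u` into
itself** (`k ∣ R`, `k > 0`). -/
theorem quarterTurn_mapsTo_coinWindow {k : ℕ} (hk : 0 < k) (u : Site 2) (σ : Coin ≃ Coin)
    (h0 : ∀ (v : Site 2) (d : Fin 2), σ (v, d, 0) =
      (![v 1 - ctr k u 1 + ctr k u 0, ctr k u 0 + ctr k u 1 - v 0 - (if d = 0 then 1 else 0)],
        Equiv.swap 0 1 d, 0))
    (h : ∀ (t : Site 2) (d : Fin 2) (j : Fin 3), j ≠ 0 → σ (t, d, j) =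
      (![t 1 - u 1 + u 0, u 0 + u 1 - t 0 - (if d = 0 then 1 else 0)], Equiv.swap 0 1 d, j))
    {R : ℕ} (hR : k ∣ R) :
    Set.MapsTo σ (coinWindow k (boxEdgesAt (ctr k u) R)) (coinWindow k (boxEdgesAt (ctr k u) R)) := by
  intro x hx
  rw [mem_coinWindow_iff] at hx ⊢
  obtain ⟨⟨v, d⟩, hvd, hxc⟩ := hx
  simp only [coinsOf, Set.mem_insert_iff, Set.mem_singleton_iff] at hxc
  rcases hxc with rfl | rfl | rfl
  · refine ⟨_, quarterTurn_edge_mem_boxEdgesAt σ h0 hvd, ?_⟩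
    rw [quarterTurn_coin_zero_eq σ h0 (v, d)]
    simp [coinsOf]
  · obtain ⟨vd', hvd', htb⟩ := quarterTurn_tuple_witness hk u σ h0 h hR hvd
    refine ⟨vd', hvd', ?_⟩
    rw [htb 1 one_ne_zero]
    simp [coinsOf]
  · obtain ⟨vd', hvd', htb⟩ := quarterTurn_tuple_witness hk u σ h0 h hR hvd
    refine ⟨vd', hvd', ?_⟩
    rw [htb 2 (by decide)]
    simp [coinsOf]

/-- **The coin window of the `R`-box about `k•u` is invariant under the coin permutation of the
quarter turn** when `k ∣ R` (`k > 0`): `σ ⁻¹' K_R = K_R`, `K_R = coinWindow k (boxEdgesAt (ctr k u) R)`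
(`σ` maps the finite set `K_R` injectively into itself, hence onto itself). -/
theorem preimage_coinWindow_quarterTurn {k : ℕ} (hk : 0 < k) (u : Site 2) (σ : Coin ≃ Coin)
    (h0 : ∀ (v : Site 2) (d : Fin 2), σ (v, d, 0) =
      (![v 1 - ctr k u 1 + ctr k u 0, ctr k u 0 + ctr k u 1 - v 0 - (if d = 0 then 1 else 0)],
        Equiv.swap 0 1 d, 0))
    (h : ∀ (t : Site 2) (d : Fin 2) (j : Fin 3), j ≠ 0 → σ (t, d, j) =
      (![t 1 - u 1 + u 0, u 0 + u 1 - t 0 - (if d = 0 then 1 else 0)], Equiv.swap 0 1 d, j))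
    {R : ℕ} (hR : k ∣ R) :
    σ ⁻¹' coinWindow k (boxEdgesAt (ctr k u) R) = coinWindow k (boxEdgesAt (ctr k u) R) := by
  have hmaps := quarterTurn_mapsTo_coinWindow hk u σ h0 h hR
  have hfin : (coinWindow k (boxEdgesAt (ctr k u) R)).Finite :=
    coinWindow_finite k (boxEdgesAt_finite _ _)
  have himage : σ '' coinWindow k (boxEdgesAt (ctr k u) R) = coinWindow k (boxEdgesAt (ctr k u) R) := by
    refine Set.eq_of_subset_of_ncard_le hmaps.image_subset ?_ hfin
    rw [Set.ncard_image_of_injective _ σ.injective]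
  ext x
  refine ⟨fun hx => ?_, fun hx => hmaps hx⟩
  rw [Set.mem_preimage, ← himage] at hx
  obtain ⟨y, hy, hxy⟩ := hx
  rwa [← σ.injective hxy]

/-- **Conditional influences are equivariant under the quarter turn about `k•u`, with the SAME
window** `K_R = coinWindow k (boxEdgesAt (ctr k u) R)` on both sides (`k ≠ 0`, `k ∣ R`; `g`, `σ`
given by their formulas; ANY event `B`, ANY condition `S₁`): the `ν_{K_R}`-signed influence,
condition `S₁`, of the coin `i` on the coin event of the rotated event `{ω | g '' ω ∈ B}` equals the
`ν_{K_R}`-signed influence, condition `σ ⁻¹' S₁`, of the coin `σ⁻¹ i` on the coin event of `B`. -/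
theorem cond_infl_quarterTurn_window {k : ℕ} (hk : k ≠ 0) (q : ℝ × ℝ) (u : Site 2)
    (g : Site 2 ≃ Site 2) (σ : Coin ≃ Coin)
    (hg : ∀ x, g x = ![ctr k u 0 + ctr k u 1 - x 1, x 0 - ctr k u 0 + ctr k u 1])
    (h0 : ∀ (v : Site 2) (d : Fin 2), σ (v, d, 0) =
      (![v 1 - ctr k u 1 + ctr k u 0, ctr k u 0 + ctr k u 1 - v 0 - (if d = 0 then 1 else 0)],
        Equiv.swap 0 1 d, 0))
    (h : ∀ (t : Site 2) (d : Fin 2) (j : Fin 3), j ≠ 0 → σ (t, d, j) =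
      (![t 1 - u 1 + u 0, u 0 + u 1 - t 0 - (if d = 0 then 1 else 0)], Equiv.swap 0 1 d, j))
    {R : ℕ} (hR : k ∣ R) (S₁ : Set Coin) (B : Set (BondConfig (Site 2))) (i : Coin) :
    ((coinLaw k q).map (fun T : Set Coin => T ∩ coinWindow k (boxEdgesAt (ctr k u) R))).real
          {T | insert i (T ∪ (S₁ \ coinWindow k (boxEdgesAt (ctr k u) R))) ∈
            cfg k ⁻¹' (BondConfig.relabel (sym2Equiv g) ⁻¹' B)} -
        ((coinLaw k q).map (fun T : Set Coin => T ∩ coinWindow k (boxEdgesAt (ctr k u) R))).real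
          {T | (T ∪ (S₁ \ coinWindow k (boxEdgesAt (ctr k u) R))) \ {i} ∈
            cfg k ⁻¹' (BondConfig.relabel (sym2Equiv g) ⁻¹' B)} =
      ((coinLaw k q).map (fun T : Set Coin => T ∩ coinWindow k (boxEdgesAt (ctr k u) R))).real
          {T | insert (σ.symm i) (T ∪ (σ ⁻¹' S₁ \ coinWindow k (boxEdgesAt (ctr k u) R))) ∈
            cfg k ⁻¹' B} -
        ((coinLaw k q).map (fun T : Set Coin => T ∩ coinWindow k (boxEdgesAt (ctr k u) R))).real
          {T | (T ∪ (σ ⁻¹' S₁ \ coinWindow k (boxEdgesAt (ctr k u) R))) \ {σ.symm i} ∈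
            cfg k ⁻¹' B} := by
  have h' := cond_infl_quarterTurn hk q u g σ hg h0 h (coinWindow k (boxEdgesAt (ctr k u) R)) S₁ B i
  rwa [preimage_coinWindow_quarterTurn (Nat.pos_of_ne_zero hk) u σ h0 h hR] at h'

end Summit.CriticalPhenomena.CardyFormulaZ2.Theorems.CardySelfRefinement.FarField

end
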